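import Mathlib
import HarnessLib.Audit
import Summits.PneNP.PneNP.Theorems.PstarGSat
import Summits.PneNP.PneNP.Theorems.PstarGSystemFreeVar

/-!
# Two constraints: the three value patterns on the solution set (ROUND-24, first step of the `|W| = 2` analysis, memo R10(v))

FRONTIER range-avoidance ladder, rung F-N3, ROUND 24 (cell `pnp-ideate`; restricted-model proof complexity — nothing here bears
on `P` versus `NP`).

A consequence of the tree theorem `PstarGSat.gSat` (T24.17′, landed by the cell's other prover seat) for TWO constraints.  Let `J` be
an output set inside the expansion range of a pure typed boundary-expanding instance with simple overlaps, and let `F₁ = (C₁, G₁, b₁)`,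
`F₂ = (C₂, G₂, b₂)` be two G-constraints whose monomial outputs avoid `J`, such that `J ∪ {F₁, F₂}` is infeasible.  If the three
G-forms `F₁`, `F₂`, `F₁ + F₂` are non-constant (`C ≠ ∅ ∨ G ≠ ∅`), then the pair (does `F₁` hold?, does `F₂` hold?) takes EXACTLY the
three values `(yes,no)`, `(no,yes)`, `(no,no)` on the solutions of `J` (`two_patterns`; `GSat` applied to `F₁`, to `F₂` and to the sum
`F₁ + F₂` — `PstarGSystemFreeVar.gval_symmDiff`).  For two genuine parity constraints this needs no side condition: in a minimal
infeasible `(J, {(C₁,b₁),(C₂,b₂)})` with `J ≠ ∅` the three forms are automatically non-constant (`PstarGSat.gapOneAll` disposes of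
the degenerate cases), so all three patterns occur on `Sol(J)` (`two_parity_patterns`) — the planner's starting point "the image of
`(f₁,f₂)` on `Sol(J')` is exactly `{01,10,11}`" (memo ROUND-24-PRESEED §13 R10(v)), here before reader substitution; after it, apply
`two_patterns` to the substituted G-constraints of `PstarReaderCore`.
-/

set_option linter.dupNamespace false

open Finset Literature.Computability.Complexity
open scoped symmDiff
open Summit.PneNP.PneNP.Theorems.PstarPDT (parity)
open Summit.PneNP.PneNP.Theorems.PstarTyped (Typed)
open Summit.PneNP.PneNP.Theorems.PstarSALevel (BoundaryExpanding SimpleOverlap)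
open Summit.PneNP.PneNP.Theorems.PstarGapLemma (Sat Feasible MinInfeasible)
open Summit.PneNP.PneNP.Theorems.PstarGapOneAll (gval gval_empty)
open Summit.PneNP.PneNP.Theorems.PstarGConstraint (gval_nonconst_iff andPairs_simple)
open Summit.PneNP.PneNP.Theorems.PstarGSystemFreeVar (gval_symmDiff)
open Summit.PneNP.PneNP.Theorems.PstarGSat (gSat gapOneAll)

namespace Summit.PneNP.PneNP.Theorems.PstarGapTwoPatterns

variable {n m : ℕ}

/-- Non-constancy of a G-form from `C ≠ ∅ ∨ G ≠ ∅` (pure instance, simple overlaps). -/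
theorem nonconst_of_ne (I : LocalMap 4 n m) (hI : I.IsPure xorAndPred) (hS : SimpleOverlap I) {C : Finset (Fin n)} {G : Finset (Fin m)}
    (h : C ≠ ∅ ∨ G ≠ ∅) : ∃ z z' : Fin n → Bool, gval I C G z ≠ gval I C G z' :=
  (gval_nonconst_iff I (andPairs_simple I hI hS G).1 (andPairs_simple I hI hS G).2).2 h

/-- **The three patterns.**  If `J ∪ {F₁, F₂}` is infeasible and `F₁`, `F₂`, `F₁ + F₂` are non-constant, then on the solutions of `J`
the constraints take exactly the value patterns (holds, fails), (fails, holds), (fails, fails). -/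
theorem two_patterns (I : LocalMap 4 n m) (hI : I.IsPure xorAndPred) (hT : Typed I) (hS : SimpleOverlap I) {r : ℕ}
    (hB : BoundaryExpanding r I) (y : Fin m → Bool) {J : Finset (Fin m)} (hJr : J.card ≤ r)
    {C₁ C₂ : Finset (Fin n)} {G₁ G₂ : Finset (Fin m)} (b₁ b₂ : Bool) (hG₁ : Disjoint J G₁) (hG₂ : Disjoint J G₂)
    (hne₁ : C₁ ≠ ∅ ∨ G₁ ≠ ∅) (hne₂ : C₂ ≠ ∅ ∨ G₂ ≠ ∅) (hne₁₂ : C₁ ∆ C₂ ≠ ∅ ∨ G₁ ∆ G₂ ≠ ∅)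
    (hinf : ¬ ∃ z : Fin n → Bool, (∀ j ∈ J, I.eval z j = y j) ∧ gval I C₁ G₁ z = b₁ ∧ gval I C₂ G₂ z = b₂) :
    (∃ z : Fin n → Bool, (∀ j ∈ J, I.eval z j = y j) ∧ gval I C₁ G₁ z = b₁ ∧ gval I C₂ G₂ z = !b₂) ∧
    (∃ z : Fin n → Bool, (∀ j ∈ J, I.eval z j = y j) ∧ gval I C₁ G₁ z = !b₁ ∧ gval I C₂ G₂ z = b₂) ∧
    (∃ z : Fin n → Bool, (∀ j ∈ J, I.eval z j = y j) ∧ gval I C₁ G₁ z = !b₁ ∧ gval I C₂ G₂ z = !b₂) := by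
  have hneq : ∀ {a b : Bool}, a ≠ b → a = !b := by decide
  refine ⟨?_, ?_, ?_⟩
  · obtain ⟨z, hz, h1⟩ := gSat n m r I hI hT hB hS y J G₁ C₁ b₁ hJr hG₁ (nonconst_of_ne I hI hS hne₁)
    have h2 : gval I C₂ G₂ z ≠ b₂ := fun h2 => hinf ⟨z, hz, h1, h2⟩
    exact ⟨z, hz, h1, hneq h2⟩
  · obtain ⟨z, hz, h2⟩ := gSat n m r I hI hT hB hS y J G₂ C₂ b₂ hJr hG₂ (nonconst_of_ne I hI hS hne₂)
    have h1 : gval I C₁ G₁ z ≠ b₁ := fun h1 => hinf ⟨z, hz, h1, h2⟩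
    exact ⟨z, hz, hneq h1, h2⟩
  · have hG : Disjoint J (G₁ ∆ G₂) := by
      rw [disjoint_iff_ne]
      rintro a ha b hb rfl
      rcases mem_symmDiff.1 hb with ⟨h, -⟩ | ⟨h, -⟩
      · exact disjoint_left.1 hG₁ ha h
      · exact disjoint_left.1 hG₂ ha h
    obtain ⟨z, hz, h12⟩ := gSat n m r I hI hT hB hS y J (G₁ ∆ G₂) (C₁ ∆ C₂) (xor b₁ b₂) hJr hG (nonconst_of_ne I hI hS hne₁₂)
    rw [gval_symmDiff] at h12
    refine ⟨z, hz, ?_⟩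
    by_cases h1 : gval I C₁ G₁ z = b₁
    · have h2 : gval I C₂ G₂ z = b₂ := by
        rw [h1] at h12
        revert h12; cases b₁ <;> cases b₂ <;> cases gval I C₂ G₂ z <;> simp
      exact absurd ⟨z, hz, h1, h2⟩ hinf
    · refine ⟨hneq h1, ?_⟩
      rw [hneq h1] at h12
      revert h12; cases b₁ <;> cases b₂ <;> cases gval I C₂ G₂ z <;> simp

/-! ## Two parity constraints -/

/-- **The three patterns for two parities.**  In a minimal infeasible `(J, {(C₁,b₁), (C₂,b₂)})` with `J ≠ ∅` (two distinct
constraints, boundary-expanding pure typed instance with simple overlaps, `|J| ≤ r`), each of the patterns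
(`C₁` right, `C₂` wrong), (`C₁` wrong, `C₂` right), (both wrong) occurs on some solution of `J`.  The degenerate cases are excluded
by minimality: an empty `C_i` or `C₁ = C₂` would make `J` minimal infeasible under at most one genuine constraint, hence empty by
`GapOneAll`. -/
theorem two_parity_patterns (I : LocalMap 4 n m) (hI : I.IsPure xorAndPred) (hT : Typed I) (hS : SimpleOverlap I) {r : ℕ}
    (hB : BoundaryExpanding r I) (y : Fin m → Bool) {J : Finset (Fin m)} (hJr : J.card ≤ r) (hJ : J.Nonempty)
    {C₁ C₂ : Finset (Fin n)} {b₁ b₂ : Bool} (hne : (C₁, b₁) ≠ (C₂, b₂))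
    (hmin : MinInfeasible I y {(C₁, b₁), (C₂, b₂)} J) :
    (∃ z : Fin n → Bool, (∀ j ∈ J, I.eval z j = y j) ∧ parity C₁ z = b₁ ∧ parity C₂ z = !b₂) ∧
    (∃ z : Fin n → Bool, (∀ j ∈ J, I.eval z j = y j) ∧ parity C₁ z = !b₁ ∧ parity C₂ z = b₂) ∧
    (∃ z : Fin n → Bool, (∀ j ∈ J, I.eval z j = y j) ∧ parity C₁ z = !b₁ ∧ parity C₂ z = !b₂) := by
  classical
  have hJne : J ≠ ∅ := hJ.ne_empty
  -- a sub-system on which `J` is still minimal infeasible has at most one constraint ⇒ contradiction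
  have hsub : ∀ W' : Finset (Finset (Fin n) × Bool), W'.card ≤ 1 →
      (∀ z, Sat W' z ↔ Sat {(C₁, b₁), (C₂, b₂)} z) → False := by
    intro W' hW' hiff
    apply hJne
    refine gapOneAll n m r I hI hT hB hS y W' J hW' hJr ⟨fun ⟨z, hzW, hzJ⟩ => hmin.1 ⟨z, (hiff z).1 hzW, hzJ⟩, fun j hj => ?_⟩
    obtain ⟨z, hzW, hzJ⟩ := hmin.2 j hj
    exact ⟨z, (hiff z).2 hzW, hzJ⟩
  have hsat2 : ∀ z, Sat {(C₁, b₁), (C₂, b₂)} z ↔ parity C₁ z = b₁ ∧ parity C₂ z = b₂ := fun z => by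
    simp [PstarGapLemma.Sat]
  have hpar0 : ∀ z : Fin n → Bool, parity (∅ : Finset (Fin n)) z = false := fun z => by simp [PstarPDT.parity]
  -- non-degeneracy
  have hC₁ : C₁ ≠ ∅ := by
    intro hC
    subst hC
    cases b₁
    · -- vacuous first constraint
      exact hsub {(C₂, b₂)} (by simp) fun z => by rw [hsat2]; simp [PstarGapLemma.Sat, hpar0]
    · -- unsatisfiable first constraint: no erasure is feasible
      obtain ⟨j, hj⟩ := hJ
      obtain ⟨z, hzW, -⟩ := hmin.2 j hj
      have := ((hsat2 z).1 hzW).1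
      rw [hpar0] at this
      exact Bool.false_ne_true this
  have hC₂ : C₂ ≠ ∅ := by
    intro hC
    subst hC
    cases b₂
    · exact hsub {(C₁, b₁)} (by simp) fun z => by rw [hsat2]; simp [PstarGapLemma.Sat, hpar0]
    · obtain ⟨j, hj⟩ := hJ
      obtain ⟨z, hzW, -⟩ := hmin.2 j hj
      have := ((hsat2 z).1 hzW).2
      rw [hpar0] at this
      exact Bool.false_ne_true this
  have hC₁₂ : C₁ ∆ C₂ ≠ ∅ := by
    intro h
    have hCC : C₁ = C₂ := symmDiff_eq_bot.1 h
    subst hCC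
    have hbb : b₁ ≠ b₂ := fun hb => hne (by rw [hb])
    -- contradictory constraints: no erasure is feasible
    obtain ⟨j, hj⟩ := hJ
    obtain ⟨z, hzW, -⟩ := hmin.2 j hj
    obtain ⟨h1, h2⟩ := (hsat2 z).1 hzW
    exact hbb (h1.symm.trans h2)
  have hinf : ¬ ∃ z : Fin n → Bool, (∀ j ∈ J, I.eval z j = y j) ∧ gval I C₁ ∅ z = b₁ ∧ gval I C₂ ∅ z = b₂ := by
    rintro ⟨z, hzJ, h1, h2⟩
    rw [gval_empty] at h1 h2
    exact hmin.1 ⟨z, (hsat2 z).2 ⟨h1, h2⟩, hzJ⟩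
  obtain ⟨⟨z₁, hz₁, a₁, a₂⟩, ⟨z₂, hz₂, b₁', b₂'⟩, ⟨z₃, hz₃, c₁, c₂⟩⟩ :=
    two_patterns I hI hT hS hB y hJr b₁ b₂ (disjoint_empty_right J) (disjoint_empty_right J) (Or.inl hC₁) (Or.inl hC₂)
      (Or.inl hC₁₂) hinf
  rw [gval_empty] at a₁ a₂ b₁' b₂' c₁ c₂
  exact ⟨⟨z₁, hz₁, a₁, a₂⟩, ⟨z₂, hz₂, b₁', b₂'⟩, ⟨z₃, hz₃, c₁, c₂⟩⟩

end Summit.PneNP.PneNP.Theorems.PstarGapTwoPatterns
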